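import Literature.MathematicalPhysics.QuantumFieldTheory.Balaban1983to89.Node00.Carriers
import Literature.MathematicalPhysics.QuantumFieldTheory.Balaban1983to89.Node00.CarriersB7

/-!
# NODE 00 (YM-PLAN Track A) — STAGE 2 OF THE WORLD-OF-RECORD CHAIN: the [Balaban1985Averaging] group joins (`carriers₂ θ X :=
# carriers₁ θ (withB7OfRecord X D L 𝔸)`), `IsWorldOfRecord₂ → IsWorldOfRecord₁`, and the DAG node N04 at every world of record, Stage 2

NODE 00 STAGE-2 MODULE (seat `pub-ymgap-node00-def`; the CONVENTIONS OF RECORD block of the root module `Node00Carriers` applies here).  APPEND-ONLY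
GROWTH of the chain (P8″ (ii)): a NEW importing module, no edit of `Node00Carriers`.  HONEST FRAMING: definitions + kernel bookkeeping; the only
analytic content is the lit-balaban theorem `B7ConclConcrete.concl_concrete` (Props. 1–10 of [Balaban1985Averaging] for the concrete `ℤᵈ` carriers,
`G = U(𝔸)`), reached through `Node00CarriersB7.b7_withB7OfRecord` BY NAME.  LOCATED READINGS of the B7 group (module docstring of `Node00CarriersB7`,
rulings Q-N00-2∕3): `ℤᵈ` carriers, Banach ∕ C⋆ coefficient algebra `𝔸` with `U(𝔸) ⊇ SU(N)`-valued configurations, the 1985 CORNER-anchored block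
prescription (the transfer to the 1987 centred prescription of [Balaban1987RG1] (0.3)–(0.4) is the row sub-item «F6-TRANSFER», NOT folded into any
definition here), `L ≥ 2`.  Nothing of the series' end statement; one finite T⁴ programme; NOT ℝ⁴ ∕ infinite volume ∕ OS ∕ mass gap ∕ Clay.

WHAT THIS FILE DEFINES AND PROVES (0 sorry; axioms standard):
* `Stage2Params extends Stage1Params` (+ the coefficient C⋆-algebra `𝔸`, print: `M_N(ℂ)` with the operator norm (19)); `Stage1Params.two_le_L`;
* `carriers₂ θ X := carriers₁ θ.toStage1Params (withB7OfRecord X θ.D θ.L θ.𝔸)` — the B7 group substituted INSIDE, so forgetting it is a Stage-1 bundle;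
* `carriers₂_b7` (leaf `b7` at `carriers₂ θ X`, any `θ`), `IsWorldOfRecord₂`, `isWorldOfRecord₁_of_isWorldOfRecord₂` (refinement, witness
  `X ↦ withB7OfRecord X …`), `isWorldOfRecord₂_of_up`;
* `b7_main_of_isWorldOfRecord₂` — **N04 · `Dag.B7_main (leavesP w P)` at every world of record, Stage 2** (shape `(w) (hw : IsWorldOfRecord₂ w) (P)`),
  and `b4_main_of_isWorldOfRecord₂ ∕ b5_main_of_isWorldOfRecord₂` (N01 ∕ N02 carried along the refinement).
-/

noncomputable section

namespace Literature.MathematicalPhysics.QuantumFieldTheory.Balaban1983to89.Node00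

open scoped Matrix
open DagBinding DagDischargedII B4GaugeCovariance

/-! ## §1. Stage-2 parameters -/

/-- **Stage-2 family parameters**: the Stage-1 parameters and the coefficient Banach ∕ C⋆-algebra `𝔸` of the [Balaban1985Averaging] carriers
(print p. 18–19: configurations in a Lie subgroup `G ⊂ U(N)`, norms through `M_N(ℂ)` with the operator norm (19); the lineage's carriers are
`U1 𝔸`-valued with `G = U(𝔸)`).  The B7 group's lattice dimension and block size are `θ.D` and `θ.L`. [cite: Balaban1985Averaging, pp.18–19 (2), (19) (parameter dictionary)] -/
structure Stage2Params extends Stage1Params where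
  /-- coefficient C⋆-algebra of the configurations (print: `M_N(ℂ)`) -/
  𝔸 : Type
  [instCStar : CStarAlgebra 𝔸]
  [instNontrivial : Nontrivial 𝔸]

-- `Stage2Params.instCStar ∕ .instNontrivial` are the instances CARRIED by the bundled coefficient algebra `θ.𝔸` — a field of `θ`, not a
-- library type — so registering them cannot override a library instance (the device of `B6.Geometry.fin`).
attribute [instance] Stage2Params.instCStar Stage2Params.instNontrivial

/-- `2 ≤ L` for Bałaban's block size `L` odd `> 1`. [cite: Balaban1987RG1, p.253 «L an odd positive integer» (bookkeeping)] -/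
theorem Stage1Params.two_le_L (θ : Stage1Params) : 2 ≤ θ.L := θ.hL.2

/-! ## §2. The Stage-2 carrier bundle of record and its `b7` leaf -/

/-- **The Stage-2 carrier bundle of record**: the B7 group := the [Balaban1985Averaging] objects of the lineage (`withB7OfRecord X D L 𝔸`: one-step and
k-step averages (42)–(43), the expansions (127) ∕ (134)–(135) ∕ (156)–(157) ∕ (164), the gauge data of Sects. E–F, constants `cB d L`, `C0 d`, `c2' d L`),
substituted INSIDE the Stage-1 bundle `carriers₁` (B4 and B5 groups of record). [cite: Balaban1985Averaging, Props. 1–10 pp.26–50; Balaban1983RegularityDecay, (1.1)–(1.7) pp.572–573; Balaban1984PropagatorsI, Props. 1.1–1.2 pp.33–36 (the lineages' concrete carriers)] -/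
def carriers₂ (θ : Stage2Params) (X : PrintedCarriersR) : PrintedCarriersR :=
  carriers₁ θ.toStage1Params (withB7OfRecord X θ.D θ.L θ.𝔸)

/-- **Leaf `b7` at `carriers₂ θ X`** (every `θ`; `L ≥ 2` from `L` odd `> 1`): `B7.Concl` by `b7_withB7OfRecord` (the B4 ∕ B5 substitutions do not
touch the B7 group; the N-binding's `b7` is the X-binding's; definitional unfolding). [cite: Balaban1985Averaging, Props. 1–10 pp.26–50 (kernel version of the lit-balaban lineage for its concrete ℤᵈ carriers)] -/
theorem carriers₂_b7 (θ : Stage2Params) (X : PrintedCarriersR) (Y : PrintedCarriers9X) (Z : PrintedCarriers11) (V : PrintedCarriers14R)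
    (W : PrintedCarriers15) : (Upstream.ofPrintedAllXPN (carriers₂ θ X) Y Z V W).b7 :=
  b7_withB7OfRecord X Y Z V W θ.D θ.L θ.toStage1Params.two_le_L θ.𝔸

/-! ## §3. The staged world-of-record predicate, Stage 2, and its refinement of Stage 1 -/

/-- **«`w` is a binding world of record, Stage 2»**: for some admissible `θ : Stage2Params`, at every run the upstream block is the N-binding over a
bundle whose B4, B5 AND B7 groups are the objects of record (`carriers₂ θ X`); everything else as in `IsWorldOfRecord₁`. [cite: Balaban1985Averaging, Props. 1–10 pp.26–50; Balaban1983RegularityDecay, (1.1)–(1.7) pp.572–573; Balaban1984PropagatorsI, Props. 1.1–1.2 pp.33–36 (objects of record, Stage 2 dictionary)] -/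
def IsWorldOfRecord₂ (w : WorldP) : Prop :=
  ∃ θ : Stage2Params, θ.toStage1Params.Admissible ∧ ∀ P : B12.RunParams,
    ∃ (X : PrintedCarriersR) (Y : PrintedCarriers9X) (Z : PrintedCarriers11) (V : PrintedCarriers14R) (W : PrintedCarriers15),
      w.up P = Upstream.ofPrintedAllXPN (carriers₂ θ X) Y Z V W

/-- **Refinement `IsWorldOfRecord₂ w → IsWorldOfRecord₁ w`** (witness `X ↦ withB7OfRecord X D L 𝔸`; `rfl`) — a node discharged at Stage 1 stays
discharged at Stage 2. [cite: Balaban1985Averaging, pp.18–19 (bookkeeping)] -/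
theorem isWorldOfRecord₁_of_isWorldOfRecord₂ (w : WorldP) (hw : IsWorldOfRecord₂ w) : IsWorldOfRecord₁ w := by
  obtain ⟨θ, hθ, hup⟩ := hw
  refine ⟨θ.toStage1Params, hθ, fun P => ?_⟩
  obtain ⟨X, Y, Z, V, W, hP⟩ := hup P
  exact ⟨withB7OfRecord X θ.D θ.L θ.𝔸, Y, Z, V, W, hP⟩

/-- The constant-binding worlds over `carriers₂ θ X` are worlds of record, Stage 2. [cite: Balaban1985Averaging, pp.18–19 (bookkeeping)] -/
theorem isWorldOfRecord₂_of_up (θ : Stage2Params) (hθ : θ.toStage1Params.Admissible) (X : PrintedCarriersR) (Y : PrintedCarriers9X)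
    (Z : PrintedCarriers11) (V : PrintedCarriers14R) (W : PrintedCarriers15) (w : WorldP)
    (hw : w.up = fun _ => Upstream.ofPrintedAllXPN (carriers₂ θ X) Y Z V W) : IsWorldOfRecord₂ w :=
  ⟨θ, hθ, fun P => ⟨X, Y, Z, V, W, by rw [hw]⟩⟩

/-! ## §4. The DAG nodes at every world of record, Stage 2 -/

/-- **N04 · [Balaban1985Averaging]: `Dag.B7_main (leavesP w P)` («b5 → b7») at every world of record (Stage 2), every run** — the antecedent is not
used; the venue slot `YMDAG.N04_holds` as a one-liner. [cite: Balaban1985Averaging, Props. 1–10 pp.26–50 (kernel version of the lit-balaban lineage)] -/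
theorem b7_main_of_isWorldOfRecord₂ (w : WorldP) (hw : IsWorldOfRecord₂ w) (P : B12.RunParams) : Dag.B7_main (leavesP w P) := by
  obtain ⟨θ, hθ, hup⟩ := hw
  obtain ⟨X, Y, Z, V, W, hP⟩ := hup P
  intro _
  show (w.up P).b7
  rw [hP]
  exact carriers₂_b7 θ X Y Z V W

/-- N01 at every world of record, Stage 2 (through the refinement). [cite: Balaban1983RegularityDecay, Theorem p.573 (kernel version of the lit-balaban r01 lineage)] -/
theorem b4_main_of_isWorldOfRecord₂ (w : WorldP) (hw : IsWorldOfRecord₂ w) (P : B12.RunParams) : Dag.B4_main (leavesP w P) :=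
  b4_main_of_isWorldOfRecord₁ w (isWorldOfRecord₁_of_isWorldOfRecord₂ w hw) P

/-- N02 at every world of record, Stage 2 (through the refinement). [cite: Balaban1984PropagatorsI, Props. 1.1–1.2 pp.33–36 (kernel versions of the lit-balaban lineages)] -/
theorem b5_main_of_isWorldOfRecord₂ (w : WorldP) (hw : IsWorldOfRecord₂ w) (P : B12.RunParams) : Dag.B5_main (leavesP w P) :=
  b5_main_of_isWorldOfRecord₁ w (isWorldOfRecord₁_of_isWorldOfRecord₂ w hw) P

end Literature.MathematicalPhysics.QuantumFieldTheory.Balaban1983to89.Node00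

end
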